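import Literature.AlgebraicGeometry.Frobenioids.Frobenioid
import Literature.AlgebraicGeometry.Frobenioids.EquivalenceUnitsTransport
import Literature.AlgebraicGeometry.Frobenioids.DivisorMonoidCategoryTheoreticityDefs
import Literature.AlgebraicGeometry.Frobenioids.BaseIdentityPreStepsProofs
import HarnessLib

/-!
# Frobenioids I, Corollary 4.11 (i): an equivalence of Frobenioids over Div-slim bases preserves the
# units `O^×(−)`

Mochizuki, *The geometry of Frobenioids I: the general theory*, Kyushu J. Math. **62** (2008)
293–400, proof of Cor. 4.11 (i), kurims text pp. 92–93 [cite: MochizukiFrdI2008, Cor. 4.11 (i) p.92]: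

> "an element `f ∈ O^×(A)` defines an automorphism `φ_f` of the natural functor `(C^pl-bk)_A → C`
> [cf. Definition 1.3, (i), (c)] which maps to the identity automorphism of the functor `D_{A_D} → D`,
> hence to the identity of `D_{A_D} → Mon` … Since `D_i` is Div-slim, `O^×(A)` may be recovered as the
> set of automorphisms of `A` arising from automorphisms of `(C^pl-bk)_A → C` all of whose induced
> automorphisms are Div-identities … Since `Ψ` preserves pull-back morphisms [Theorem 3.4, (iii)] and
> Div-identity automorphisms [Theorem 4.2, (i)], we conclude that `Ψ` preserves `O^×(−)`."

PROOF-ONLY file (seat abc-iut-L1-t10 gen 2; PIECE of the D-ζ-b′ row of abc-iut-L1-d6, whose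
`UnitTrivialisationFunctoriality.lean` consumes the main theorem). Over found's Def. 1.2/1.3 API
(`PreFrobenioid.unitsSubgroup`, `PullbackCat`, `pullbackSliceToBase`, `IsFrobenioid.i_c`) and the §4
interface predicate `PreFrobenioidData.IsDivSlim` (Def. 4.5 (iv), seat abc-iut-L1-t3):

* `base_app_eq_id_of_forall_isDivIdentity` — the Div-slim characterization (one Frobenioid): a natural
  automorphism of `(C^pl-bk)_B → C` all of whose components are Div-identities has base-identity
  components (its shadow on `D_{B_D} → D`, through the equivalence `(C^pl-bk)_B ⥲ D_{B_D}` of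
  Def. 1.3 (i)(c), acts trivially on `Φ`, hence is trivial by Div-slimness);
* `exists_natIso_of_mem_unitsSubgroup` — `φ_f`: a base-identity automorphism `f` of `A` extends to a
  natural automorphism of `(C^pl-bk)_A → C` with base-identity components (unique lifting along
  pull-back morphisms, Def. 1.2 (ii) / Prop. 1.11 (iii): `PreFrobenioidData.existsUnique_lift_of_isBaseIdentity`
  of `BaseIdentityPreStepsProofs.lean`);
* `mapIso_mem_unitsSubgroup_of_isDivSlim` — **`Ψ` preserves `O^×(−)`**: for an equivalence `Ψ : C₁ ⥲ C₂`
  such that `Ψ⁻¹` carries pull-back morphisms to pull-back morphisms (Thm. 3.4 (iii)) and `Ψ` carries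
  Div-identity endomorphisms to Div-identity endomorphisms (Thm. 4.2 (i)), `D₂` Div-slim:
  `f ∈ O^×(A) ⇒ Ψ(f) ∈ O^×(Ψ A)`.

The inputs from Thm. 3.4 (iii) / Thm. 4.2 (i) are explicit hypotheses (named facts of seats
abc-iut-L1-t13 / t14). No statement of the paper is restated or strengthened; nothing here is specific
to the abc programme.
-/

namespace Literature.AlgebraicGeometry.Frobenioids

open CategoryTheory Opposite

universe w v v' u u'

namespace PreFrobenioid

section OneFrobenioid

variable {D : Type u} [Category.{v} D] {Φ : Dᵒᵖ ⥤ CommMonCat.{w}}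
  {C : Type u'} [Category.{v'} C] {F : C ⥤ ElemFrobenioid Φ}

/-! ### Div-identity endomorphisms: two closure properties -/

/-- A base-identity endomorphism is a Div-identity endomorphism (`id^* = id`).
[cite: MochizukiFrdI2008, Def. 1.2 (ii) p.22] -/
theorem isDivIdentity_of_isBaseIdentity {A : C} {φ : A ⟶ A} (h : IsBaseIdentity F φ) :
    IsDivIdentity F φ := by
  unfold IsDivIdentity
  rw [h]
  exact MonoidHom.ext fun x => pull_id Φ _ x

/-- Conjugating a Div-identity endomorphism by an isomorphism gives a Div-identity endomorphism
(`(e⁻¹ f e)^* = e^* ∘ f^* ∘ (e⁻¹)^*`). [cite: MochizukiFrdI2008, Def. 1.2 (ii) p.22] -/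
theorem IsDivIdentity.conj_iso {A B : C} {φ : A ⟶ A} (h : IsDivIdentity F φ) (e : A ≅ B) :
    IsDivIdentity F (e.inv ≫ φ ≫ e.hom) := by
  unfold IsDivIdentity at h ⊢
  refine MonoidHom.ext fun x => ?_
  rw [base_comp, base_comp, pull_comp, pull_comp, MonoidHom.id_apply]
  have h' : pull Φ (Base F φ) (pull Φ (Base F e.hom) x) = pull Φ (Base F e.hom) x := by
    rw [h, MonoidHom.id_apply]
  rw [h', ← pull_comp, ← base_comp, e.inv_hom_id, base_id, pull_id]

/-! ### The Div-slim characterization (one Frobenioid, Div-slim base) -/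

/-- For a Frobenioid over a DIV-SLIM base: a natural automorphism `ν` of the forgetful functor
`(C^pl-bk)_B → C` all of whose components are Div-identity endomorphisms has BASE-IDENTITY
components. (Through the equivalence `(C^pl-bk)_B ⥲ D_{B_D}` of Def. 1.3 (i)(c), `Base(ν)` is an
automorphism of `D_{B_D} → D` acting trivially on `Φ`, hence trivial by Def. 4.5 (iv); FrdI proof of
Cor. 4.11 (i), p. 92–93.) [cite: MochizukiFrdI2008, Cor. 4.11 (i) p.92] -/
theorem base_app_eq_id_of_forall_isDivIdentity (hF : IsFrobenioid F)
    (hds : (PreFrobenioidData.ofFunctor Φ F).IsDivSlim) {B : C}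
    (ν : Over.forget (⟨B⟩ : PullbackCat F) ⋙ wideSubcategoryInclusion (pullbackMorphisms F) ≅
      Over.forget (⟨B⟩ : PullbackCat F) ⋙ wideSubcategoryInclusion (pullbackMorphisms F))
    (hν : ∀ W, IsDivIdentity F (ν.hom.app W)) (W : Over (⟨B⟩ : PullbackCat F)) :
    Base F (ν.hom.app W) = 𝟙 _ := by
  -- the equivalence `T : (C^pl-bk)_B ⥲ D_{B_D}` of Def. 1.3 (i)(c) and the forgetful `G : D_{B_D} → D`
  let T := pullbackSliceToBase F B
  haveI : T.IsEquivalence := hF.i_c B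
  let X₀ : D := (wideSubcategoryInclusion (pullbackMorphisms F) ⋙ baseFunctor F).obj ⟨B⟩
  let G : Over X₀ ⥤ D := Over.forget X₀
  -- `Base(ν)` as an automorphism `β` of `T ⋙ G`
  let β : T ⋙ G ≅ T ⋙ G := NatIso.ofComponents
    (fun W => (baseFunctor F).mapIso (ν.app W)) (by
      intro W W' m
      exact (Functor.isoWhiskerRight ν (baseFunctor F)).hom.naturality m)
  -- `β` descends to an automorphism `γ` of `G` along the equivalence `T`
  let e : Over (⟨B⟩ : PullbackCat F) ≌ Over X₀ := T.asEquivalence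
  let Wh : (Over X₀ ⥤ D) ⥤ (Over (⟨B⟩ : PullbackCat F) ⥤ D) := (e.congrLeft (E := D)).inverse
  let hWh : Wh.FullyFaithful := (e.congrLeft (E := D)).fullyFaithfulInverse
  let γ : G ≅ G := hWh.preimageIso β
  have hγβ : Wh.mapIso γ = β := hWh.isoEquiv.apply_symm_apply β
  have hγT : ∀ W : Over (⟨B⟩ : PullbackCat F), γ.hom.app (T.obj W) = β.hom.app W := fun W => by
    have := congrArg (fun i : T ⋙ G ≅ T ⋙ G => i.hom.app W) hγβ
    exact this.symm ▸ rfl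
  -- every component of `γ` acts trivially on `Φ`
  have hγtriv : ∀ (V : Over X₀) (x : (PreFrobenioidData.ofFunctor Φ F).Mon V.left),
      (PreFrobenioidData.ofFunctor Φ F).pull (γ.hom.app V) x = x := by
    intro V x
    let W := T.objPreimage V
    let i : T.obj W ≅ V := T.objObjPreimageIso V
    have hnat : γ.hom.app V = G.map i.inv ≫ γ.hom.app (T.obj W) ≫ G.map i.hom := by
      have h := γ.hom.naturality i.hom
      rw [← h, ← Category.assoc, ← G.map_comp, i.inv_hom_id, G.map_id, Category.id_comp]
    have hW : pull Φ (γ.hom.app (T.obj W)) = MonoidHom.id _ := by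
      rw [hγT W]
      exact hν W
    change pull Φ (γ.hom.app V) x = x
    rw [hnat, pull_comp, pull_comp, hW, MonoidHom.id_apply, ← pull_comp, ← G.map_comp,
      i.inv_hom_id, G.map_id, pull_id]
  -- Div-slimness: `γ` is trivial, hence so is `β`
  have hγ1 : γ = Iso.refl G := hds.eq_one X₀ γ hγtriv
  have hβ1 : β.hom.app W = 𝟙 _ := by
    rw [← hγT W, hγ1]
    rfl
  exact hβ1

/-! ### `φ_f`: a unit extends to a natural automorphism of `(C^pl-bk)_A → C` -/

/-- The inverse of a base-identity automorphism is base-identity. [cite: MochizukiFrdI2008, Def. 1.2 (ii) p.21] -/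
theorem isBaseIdentity_inv {A : C} (f : A ≅ A) (hf : IsBaseIdentity F f.hom) : IsBaseIdentity F f.inv := by
  unfold IsBaseIdentity at hf ⊢
  have h : Base F (f.hom ≫ f.inv) = 𝟙 _ := by rw [f.hom_inv_id, base_id]
  rwa [base_comp, hf, Category.id_comp] at h

/-- Conjugating a base-identity endomorphism by an isomorphism gives a base-identity endomorphism.
[cite: MochizukiFrdI2008, Def. 1.2 (ii) p.21] -/
theorem IsBaseIdentity.conj_iso {A B : C} {φ : A ⟶ A} (h : IsBaseIdentity F φ) (e : A ≅ B) :
    IsBaseIdentity F (e.inv ≫ φ ≫ e.hom) := by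
  unfold IsBaseIdentity at h ⊢
  rw [base_comp, base_comp, h, Category.id_comp, ← base_comp, e.inv_hom_id, base_id]

/-- **`φ_f`** (FrdI proof of Cor. 4.11 (i), p. 92: "an element `f ∈ O^×(A)` defines an automorphism `φ_f`
of the natural functor `(C^pl-bk)_A → C` [cf. Definition 1.3, (i), (c)]"): a base-identity automorphism
`f` of `A` extends to a natural automorphism of `(C^pl-bk)_A → C` whose components are base-identity and
which lies over `f` (`γ ∘ ν_{(X, γ)} = f ∘ γ` for every pull-back morphism `γ : X → A`).
[cite: MochizukiFrdI2008, Cor. 4.11 (i) p.92] -/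
theorem exists_natIso_of_isBaseIdentity {A : C} (f : A ≅ A) (hf : IsBaseIdentity F f.hom) :
    ∃ ν : Over.forget (⟨A⟩ : PullbackCat F) ⋙ wideSubcategoryInclusion (pullbackMorphisms F) ≅
        Over.forget (⟨A⟩ : PullbackCat F) ⋙ wideSubcategoryInclusion (pullbackMorphisms F),
      (∀ W, IsBaseIdentity F (ν.hom.app W)) ∧
        ∀ W : Over (⟨A⟩ : PullbackCat F), ν.hom.app W ≫ W.hom.hom = W.hom.hom ≫ f.hom := by
  have hf' : IsBaseIdentity F f.inv := isBaseIdentity_inv f hf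
  -- the lifts of `f` and `f⁻¹` along each pull-back morphism `γ_W : X_W → A`
  have hex : ∀ W : Over (⟨A⟩ : PullbackCat F),
      ∃! g : W.left.obj ⟶ W.left.obj, g ≫ W.hom.hom = W.hom.hom ≫ f.hom ∧ Base F g = 𝟙 _ :=
    fun W => PreFrobenioidData.existsUnique_lift_of_isBaseIdentity (PreFrobenioidData.ofFunctor Φ F)
      ((PreFrobenioidData.ofFunctor_isPullbackMorphism F _).mpr W.hom.property) f.hom hf
  have hex' : ∀ W : Over (⟨A⟩ : PullbackCat F),
      ∃! g : W.left.obj ⟶ W.left.obj, g ≫ W.hom.hom = W.hom.hom ≫ f.inv ∧ Base F g = 𝟙 _ :=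
    fun W => PreFrobenioidData.existsUnique_lift_of_isBaseIdentity (PreFrobenioidData.ofFunctor Φ F)
      ((PreFrobenioidData.ofFunctor_isPullbackMorphism F _).mpr W.hom.property) f.inv hf'
  choose g hg hgb using fun W => (hex W).exists
  choose g' hg' hg'b using fun W => (hex' W).exists
  -- uniqueness of lifts over the identity along `γ_W`
  have huniq : ∀ (W : Over (⟨A⟩ : PullbackCat F)) (k : A ⟶ A) (_ : IsBaseIdentity F k)
      (a b : W.left.obj ⟶ W.left.obj),
      a ≫ W.hom.hom = W.hom.hom ≫ k → Base F a = 𝟙 _ → b ≫ W.hom.hom = W.hom.hom ≫ k → Base F b = 𝟙 _ →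
        a = b := by
    intro W k hk a b ha hab hb hbb
    exact (PreFrobenioidData.existsUnique_lift_of_isBaseIdentity (PreFrobenioidData.ofFunctor Φ F)
      ((PreFrobenioidData.ofFunctor_isPullbackMorphism F _).mpr W.hom.property) k hk).unique ⟨ha, hab⟩ ⟨hb, hbb⟩
  have hgg' : ∀ W, g W ≫ g' W = 𝟙 _ := by
    intro W
    refine huniq W (𝟙 A) (base_id F A) _ _ ?_ ?_ (by rw [Category.id_comp, Category.comp_id]) (base_id F _)
    · rw [Category.assoc, hg' W, ← Category.assoc, hg W, Category.assoc, f.hom_inv_id]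
    · rw [base_comp, hgb W, hg'b W, Category.comp_id]
  have hg'g : ∀ W, g' W ≫ g W = 𝟙 _ := by
    intro W
    refine huniq W (𝟙 A) (base_id F A) _ _ ?_ ?_ (by rw [Category.id_comp, Category.comp_id]) (base_id F _)
    · rw [Category.assoc, hg W, ← Category.assoc, hg' W, Category.assoc, f.inv_hom_id]
    · rw [base_comp, hg'b W, hgb W, Category.comp_id]
  refine ⟨NatIso.ofComponents (fun W => ⟨g W, g' W, hgg' W, hg'g W⟩) ?_, fun W => hgb W,
    fun W => hg W⟩
  -- naturality: both `m ∘ g_{W'}`-type composites are lifts of `f` along `γ_{W'}` over `Base(m)`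
  intro W W' m
  change m.left.hom ≫ g W' = g W ≫ m.left.hom
  have hm : m.left.hom ≫ W'.hom.hom = W.hom.hom := congrArg InducedWideCategory.Hom.hom (Over.w m)
  have hW' := (PreFrobenioidData.ofFunctor_isPullbackMorphism F W'.hom.hom).mpr W'.hom.property
  refine (hW' (W.hom.hom ≫ f.hom) (Base F m.left.hom) ?_).unique ⟨?_, ?_⟩ ⟨?_, ?_⟩
  · change Base F m.left.hom ≫ Base F W'.hom.hom = Base F (W.hom.hom ≫ f.hom)
    unfold IsBaseIdentity at hf
    rw [← base_comp, hm, base_comp, hf, Category.comp_id]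
  · rw [Category.assoc, hg W', ← Category.assoc, hm]
  · change Base F (m.left.hom ≫ g W') = Base F m.left.hom
    rw [base_comp, hgb W', Category.comp_id]
  · rw [Category.assoc, hm, hg W]
  · change Base F (g W ≫ m.left.hom) = Base F m.left.hom
    rw [base_comp, hgb W, Category.id_comp]

end OneFrobenioid

section TwoFrobenioids

variable {D₁ : Type u} [Category.{v} D₁] {Φ₁ : D₁ᵒᵖ ⥤ CommMonCat.{w}} {C₁ : Type u'} [Category.{v'} C₁]
  {D₂ : Type u} [Category.{v} D₂] {Φ₂ : D₂ᵒᵖ ⥤ CommMonCat.{w}} {C₂ : Type u'} [Category.{v'} C₂]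

/-- **[FrdI] Cor. 4.11 (i), "`Ψ` preserves `O^×(−)`"** (proof p. 92–93), over a DIV-SLIM base `D₂`: for an
equivalence `Ψ : C₁ ⥲ C₂` of (pre-)Frobenioids such that a quasi-inverse `Ψ⁻¹` carries pull-back morphisms
to pull-back morphisms (Thm. 3.4 (iii), hypothesis `hpb'`) and `Ψ` carries Div-identity endomorphisms to
Div-identity endomorphisms (Thm. 4.2 (i), hypothesis `hdi`), and `C₂ → F_{Φ₂}` a Frobenioid over a Div-slim
`D₂`: if `f ∈ O^×(A)` then `Ψ(f) ∈ O^×(Ψ A)`. (Route: `f̃ := Ψ⁻¹Ψ f ∈ O^×(Ψ⁻¹Ψ A)` extends to `φ_{f̃}` on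
`(C₁^pl-bk)_{Ψ⁻¹ΨA} → C₁`; transporting along `Ψ` gives an automorphism of `(C₂^pl-bk)_{ΨA} → C₂` with
Div-identity components and component `Ψ(f)` at the identity; by the Div-slim characterization its
components are base-identity.) No Div-slimness of `D₁`, no hypothesis on `Ψ` and pull-backs, and no
Frobenioid axiom for `C₁` is needed in this direction. [cite: MochizukiFrdI2008, Cor. 4.11 (i) p.92] -/
theorem mapIso_mem_unitsSubgroup_of_isDivSlim (F₁ : C₁ ⥤ ElemFrobenioid Φ₁) (F₂ : C₂ ⥤ ElemFrobenioid Φ₂)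
    (Ψ : C₁ ≌ C₂) (hF₂ : IsFrobenioid F₂) (hds₂ : (PreFrobenioidData.ofFunctor Φ₂ F₂).IsDivSlim)
    (hpb' : PreFrobenioidData.PreservesMor Ψ.inverse (PreFrobenioidData.ofFunctor Φ₂ F₂).IsPullbackMorphism
      (PreFrobenioidData.ofFunctor Φ₁ F₁).IsPullbackMorphism)
    (hdi : ∀ (A : C₁) (φ : A ⟶ A), (PreFrobenioidData.ofFunctor Φ₁ F₁).IsDivIdentity φ →
      (PreFrobenioidData.ofFunctor Φ₂ F₂).IsDivIdentity (Ψ.functor.map φ))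
    {A : C₁} (f : Aut A) (hf : f ∈ unitsSubgroup F₁ A) :
    Ψ.functor.mapIso f ∈ unitsSubgroup F₂ (Ψ.functor.obj A) := by
  -- view `f` as a plain isomorphism `A ≅ A`
  obtain ⟨f, rfl⟩ : ∃ g : A ≅ A, g = f := ⟨f, rfl⟩
  have hfb : IsBaseIdentity F₁ f.hom := (show IsBaseIdentity F₁ f.hom ∧ IsLinear F₁ f.hom from hf).1
  -- pull-back morphisms of `C₂` go to pull-back morphisms of `C₁` under `Ψ⁻¹` (found's rendering)
  have hpbk : ∀ {Y Z : C₂} (δ : Y ⟶ Z), IsPullbackMorphism F₂ δ → IsPullbackMorphism F₁ (Ψ.inverse.map δ) :=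
    fun δ hδ => (PreFrobenioidData.ofFunctor_isPullbackMorphism F₁ _).mp
      (hpb' δ ((PreFrobenioidData.ofFunctor_isPullbackMorphism F₂ δ).mpr hδ))
  -- the unit `f̃ := Ψ⁻¹Ψ f` of `Ψ⁻¹Ψ A` and its `φ_{f̃}` (one-Frobenioid construction in `C₁`)
  have hft : IsBaseIdentity F₁ (Ψ.inverse.mapIso (Ψ.functor.mapIso f)).hom := by
    have h := hfb.conj_iso (Ψ.unitIso.app A)
    have e : (Ψ.inverse.mapIso (Ψ.functor.mapIso f)).hom =
        (Ψ.unitIso.app A).inv ≫ f.hom ≫ (Ψ.unitIso.app A).hom := Ψ.inv_fun_map _ _ f.hom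
    unfold IsBaseIdentity at h ⊢
    rw [e]
    exact h
  obtain ⟨ν₁, hν₁b, hν₁c⟩ := exists_natIso_of_isBaseIdentity (Ψ.inverse.mapIso (Ψ.functor.mapIso f)) hft
  -- transport: the slice object of `(C₁^pl-bk)_{Ψ⁻¹ΨA}` under an object `(Y, δ)` of `(C₂^pl-bk)_{ΨA}`
  let toW₁ : Over (⟨Ψ.functor.obj A⟩ : PullbackCat F₂) →
      Over (⟨Ψ.inverse.obj (Ψ.functor.obj A)⟩ : PullbackCat F₁) := fun W =>
    Over.mk (⟨Ψ.inverse.map W.hom.hom, hpbk W.hom.hom W.hom.property⟩ :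
      (⟨Ψ.inverse.obj W.left.obj⟩ : PullbackCat F₁) ⟶ (⟨Ψ.inverse.obj (Ψ.functor.obj A)⟩ : PullbackCat F₁))
  -- the components of `φ_{f̃}` and the counit, under names with their types spelled out
  have hnIty : ∀ W : Over (⟨Ψ.functor.obj A⟩ : PullbackCat F₂),
      ∃ e : Ψ.inverse.obj W.left.obj ≅ Ψ.inverse.obj W.left.obj, e = ν₁.app (toW₁ W) :=
    fun W => ⟨_, rfl⟩
  choose nI hnI using hnIty
  have hnIhom : ∀ W, (nI W).hom = ν₁.hom.app (toW₁ W) := fun W => by rw [hnI W]; rfl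
  have hεty : ∀ Y : C₂, ∃ e : Ψ.functor.obj (Ψ.inverse.obj Y) ≅ Y, e = Ψ.counitIso.app Y :=
    fun Y => ⟨_, rfl⟩
  choose ε hε₀ using hεty
  have hε : ∀ {Y Y' : C₂} (g : Y ⟶ Y'), g ≫ (ε Y').inv = (ε Y).inv ≫ Ψ.functor.map (Ψ.inverse.map g) := by
    intro Y Y' g
    rw [hε₀ Y, hε₀ Y']
    have := Ψ.counitIso.inv.naturality g
    dsimp at this
    exact this
  have hε' : ∀ {Y Y' : C₂} (g : Y ⟶ Y'),
      Ψ.functor.map (Ψ.inverse.map g) ≫ (ε Y').hom = (ε Y).hom ≫ g := by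
    intro Y Y' g
    rw [hε₀ Y, hε₀ Y']
    have := Ψ.counitIso.hom.naturality g
    dsimp at this
    exact this
  -- the components `ν₂_{(Y,δ)} := ε_Y ∘ Ψ(ν₁_{(Ψ⁻¹Y, Ψ⁻¹δ)}) ∘ ε_Y⁻¹`
  let c : ∀ W : Over (⟨Ψ.functor.obj A⟩ : PullbackCat F₂), W.left.obj ≅ W.left.obj := fun W =>
    (ε W.left.obj).symm ≪≫ Ψ.functor.mapIso (nI W) ≪≫ ε W.left.obj
  have hc : ∀ W, (c W).hom = (ε W.left.obj).inv ≫ Ψ.functor.map (nI W).hom ≫ (ε W.left.obj).hom :=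
    fun W => rfl
  -- the natural automorphism `ν₂` of `(C₂^pl-bk)_{ΨA} → C₂`
  let ν₂ : Over.forget (⟨Ψ.functor.obj A⟩ : PullbackCat F₂) ⋙ wideSubcategoryInclusion (pullbackMorphisms F₂) ≅
      Over.forget (⟨Ψ.functor.obj A⟩ : PullbackCat F₂) ⋙ wideSubcategoryInclusion (pullbackMorphisms F₂) :=
    NatIso.ofComponents c (by
      intro W W' m
      have hmty : ∃ mh : W.left.obj ⟶ W'.left.obj, mh = m.left.hom := ⟨_, rfl⟩
      obtain ⟨mh, hmh⟩ := hmty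
      change m.left.hom ≫ (c W').hom = (c W).hom ≫ m.left.hom
      rw [← hmh, hc W, hc W']
      have hm : mh ≫ W'.hom.hom = W.hom.hom := by
        rw [hmh]
        exact congrArg InducedWideCategory.Hom.hom (Over.w m)
      have hmpb : IsPullbackMorphism F₂ mh := by
        rw [hmh]
        exact m.left.property
      -- the corresponding slice morphism over `Ψ⁻¹ΨA`
      let m₁ : toW₁ W ⟶ toW₁ W' := Over.homMk
        (⟨Ψ.inverse.map mh, hpbk mh hmpb⟩ :
          (⟨Ψ.inverse.obj W.left.obj⟩ : PullbackCat F₁) ⟶ ⟨Ψ.inverse.obj W'.left.obj⟩) (by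
          apply InducedWideCategory.Hom.ext
          change Ψ.inverse.map mh ≫ Ψ.inverse.map W'.hom.hom = Ψ.inverse.map W.hom.hom
          rw [← Functor.map_comp, hm])
      have key : Ψ.inverse.map mh ≫ (nI W').hom = (nI W).hom ≫ Ψ.inverse.map mh := by
        rw [hnIhom W, hnIhom W']
        exact ν₁.hom.naturality m₁
      have key' : Ψ.functor.map (Ψ.inverse.map mh) ≫ Ψ.functor.map (nI W').hom =
          Ψ.functor.map (nI W).hom ≫ Ψ.functor.map (Ψ.inverse.map mh) := by
        rw [← Functor.map_comp, key, Functor.map_comp]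
      rw [← Category.assoc, hε mh, Category.assoc, ← Category.assoc (Ψ.functor.map _), key',
        Category.assoc, hε' mh]
      simp only [Category.assoc])
  have hν₂app : ∀ W, ν₂.hom.app W = (c W).hom := fun W => rfl
  -- the components of `ν₂` are Div-identities (`Ψ` carries Div-identities to Div-identities)
  have hν₂ : ∀ W, IsDivIdentity F₂ (ν₂.hom.app W) := by
    intro W
    rw [hν₂app W, hc W]
    have h1 : IsDivIdentity F₁ (nI W).hom := by
      rw [hnIhom W]
      exact isDivIdentity_of_isBaseIdentity (hν₁b (toW₁ W))
    have h2 : IsDivIdentity F₂ (Ψ.functor.map (nI W).hom) :=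
      (PreFrobenioidData.ofFunctor_isDivIdentity F₂ _).mp
        (hdi _ _ ((PreFrobenioidData.ofFunctor_isDivIdentity F₁ _).mpr h1))
    exact h2.conj_iso (ε W.left.obj)
  -- Div-slimness of `D₂`: the components of `ν₂` are base-identity; evaluate at `(ΨA, id)`
  let W₀ : Over (⟨Ψ.functor.obj A⟩ : PullbackCat F₂) := Over.mk (𝟙 (⟨Ψ.functor.obj A⟩ : PullbackCat F₂))
  have hbase : Base F₂ (ν₂.hom.app W₀) = 𝟙 _ := base_app_eq_id_of_forall_isDivIdentity hF₂ hds₂ ν₂ hν₂ W₀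
  -- `ν₂_{(ΨA, id)} = Ψ(f)`
  set n₀ : Ψ.inverse.obj (Ψ.functor.obj A) ⟶ Ψ.inverse.obj (Ψ.functor.obj A) := (nI W₀).hom with hn₀def
  have hn₀ : n₀ = Ψ.inverse.map (Ψ.functor.map f.hom) := by
    have h : n₀ ≫ Ψ.inverse.map (𝟙 (Ψ.functor.obj A)) =
        Ψ.inverse.map (𝟙 (Ψ.functor.obj A)) ≫ Ψ.inverse.map (Ψ.functor.map f.hom) := by
      have h0 := hν₁c (toW₁ W₀)
      rw [← hnIhom W₀] at h0
      exact h0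
    rwa [CategoryTheory.Functor.map_id, Category.comp_id, Category.id_comp] at h
  have hW₀ : ν₂.hom.app W₀ = Ψ.functor.map f.hom := by
    change (ε (Ψ.functor.obj A)).inv ≫ Ψ.functor.map n₀ ≫ (ε (Ψ.functor.obj A)).hom = Ψ.functor.map f.hom
    rw [hn₀, hε' (Ψ.functor.map f.hom), ← Category.assoc, (ε (Ψ.functor.obj A)).inv_hom_id,
      Category.id_comp]
  rw [hW₀] at hbase
  exact ⟨hbase, degFr_iso_hom F₂ (Ψ.functor.mapIso f)⟩

end TwoFrobenioids

end PreFrobenioid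

end Literature.AlgebraicGeometry.Frobenioids
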